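import Mathlib
import HarnessLib
import Literature.Analysis.Calculus.MajorantNewtonSequence

/-!
# Kantorovich's polynomial `p(s) = (M/2)s² − s/β + η/β`, its Newton sequence, and the error bounds `s* − sₙ` (Ezquerro–Hernández 2017, Theorem 1.21, (1.21)–(1.23), (1.2))

Topic `Literature/Analysis/Calculus`, companion of `MajorantNewtonSequence.lean` (Newton's method for a
convex majorant) and of the Newton–Kantorovich files; see also `MajorantOstrowskiErrorBounds.lean`
(Theorem 2.18 for a general factored majorant `(t* − t)(t** − t)g(t)`: here `g ≡ M/2`, `Q₁ ≡ 1`, and the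
two-sided bounds become the exact closed forms below, proved directly) and
`KantorovichRecurrenceRelations.lean` (Kantorovich's recurrence system (1.3)–(1.5) over abstract
sequences; here the numbers are evaluated along the Newton sequence of the polynomial itself).  In Kantorovich's majorant technique for an operator
with `‖Γ₀‖ ≤ β`, `‖Γ₀F(x₀)‖ ≤ η`, `‖F''(x)‖ ≤ M` (J. A. Ezquerro Fernández, M. Á. Hernández Verón, *Newton's
Method: an Updated Approach of Kantorovich's Theory*, Birkhäuser 2017 [EzquerrofernandezHernandezveron2017],
§1.1.2–§1.1.4) the majorant function is the quadratic polynomial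

  `p(s) = (M/2) s² − s/β + η/β`                                                            (1.21)/(1.23)

whose zeros, when `h = Mβη ≤ 1/2`, are `s* = (1 − √(1 − 2h))/(Mβ) = (1 − √(1 − 2h)) η / h` and
`s** = (1 + √(1 − 2h))/(Mβ)`.  **Theorem 1.21**: the Newton sequence `s₀ = 0`, `s_{n+1} = sₙ − p(sₙ)/p'(sₙ)`
is nondecreasing and converges to `s*`.  Writing `aₙ = s* − sₙ`, `bₙ = s** − sₙ` one has
`p(sₙ) = (M/2)aₙbₙ`, `p'(sₙ) = −(M/2)(aₙ + bₙ)`, hence the exact recurrences `a_{n+1} = aₙ²/(aₙ + bₙ)`,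
`b_{n+1} = bₙ²/(aₙ + bₙ)` (Ostrowski's technique, §2.1.3.4, Theorem 2.18 with `g ≡ M/2`), the closed forms
`s* − sₙ = (s** − s*) θ^(2ⁿ) / (1 − θ^(2ⁿ))`, `θ = s*/s**` (`h < 1/2`) and `s* − sₙ = s*/2ⁿ` (`h = 1/2`), and
Kantorovich's a priori estimate

  `s* − sₙ ≤ (1/2^(n−1)) (2h)^(2ⁿ − 1) η`,                                                        (1.2)

which is the error bound `‖x* − xₙ‖ ≤ s* − sₙ` of the Newton–Kantorovich theorem (Theorem 1.1) made explicit.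

Held copy: `lit read book:ezquerro-fernandez2017-newtons-method-updated-approach-kantorovichs-theory`,
p. 33 (Theorem 1.1, (1.2)), p. 48–49 (Theorem 1.21, (1.21)), p. 50 ((1.23)), p. 56 (Theorem 1.29),
p. 86 (Theorem 2.18, `φ(t) = (t* − t)(t** − t)g(t)`).

## Rendering (what is typed)

* No definitions: the polynomial is written out, `p s = M / 2 * s ^ 2 - s / β + η / β`,
  `p' s = M * s - 1 / β`; the zeros are variables `sstar`, `sss` constrained by hypotheses
  `sstar = (1 - √(1 - 2 * (M * β * η))) / (M * β)`, `sss = (1 + √(1 - 2 * (M * β * η))) / (M * β)`;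
  the standing hypotheses are `0 < M`, `0 < β`, `0 ≤ η`, `M * β * η ≤ 1 / 2`.
* The Newton sequence is an arbitrary `s : ℕ → ℝ` with `s 0 = 0` and
  `s (n + 1) = s n - (M / 2 * s n ^ 2 - s n / β + η / β) / (M * s n - 1 / β)`.

## Contents (everything below is proved; no definitions, no named facts)

Vieta relations and the factorization `p(s) = (M/2)(s* − s)(s** − s)`; `0 ≤ η ≤ s* ≤ s**`,
`s* = 2η/(1 + √(1 − 2h)) ≤ 2η`, `s* s** … `; `p(s*) = 0`, `p > 0` on `(−∞, s*)`; derivatives; the initial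
values `−1/p'(0) = β`, `−p(0)/p'(0) = η`; Theorem 1.21 (monotone convergence to `s*`, first step `s₁ = η`);
the recurrences for `aₙ`, `bₙ`; the invariant `bₙ − aₙ = s** − s*`; the closed forms; the step bound
`s* − sₙ ≤ 2(s_{n+1} − sₙ)`; the contraction factors `q_{n+1} ≤ 2qₙ²`, `2qₙ ≤ (2h)^(2ⁿ)`; and (1.2).
-/

open Set Filter Topology

namespace Literature.Analysis.Calculus

section KantorovichPolynomial

variable {M β η sstar sss : ℝ}

/-- **Vieta relations and factorization of Kantorovich's polynomial (1.21)/(1.23):** with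
`D = √(1 − 2h)`, `h = Mβη ≤ 1/2`, the numbers `s* = (1 − D)/(Mβ)`, `s** = (1 + D)/(Mβ)` satisfy
`s* + s** = 2/(Mβ)`, `s* s** = 2η/(Mβ)` and `p(s) = (M/2)(s* − s)(s** − s)` for every `s`.
[cite: EzquerrofernandezHernandezveron2017, §1.1.2 Theorem 1.21 ("two positive zeros s* ≤ s**"), (1.21); §1.1.3 (1.23); §2.1.3.4 (φ(t) = (t* − t)(t** − t)g(t), p. 86)] -/
theorem kantorovichPolynomial_factor (hM : 0 < M) (hβ : 0 < β) (hh : M * β * η ≤ 1 / 2)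
    (hs : sstar = (1 - √(1 - 2 * (M * β * η))) / (M * β))
    (hss : sss = (1 + √(1 - 2 * (M * β * η))) / (M * β)) :
    sstar + sss = 2 / (M * β) ∧ sstar * sss = 2 * η / (M * β) ∧
      ∀ s : ℝ, M / 2 * s ^ 2 - s / β + η / β = M / 2 * (sstar - s) * (sss - s) := by
  set D := √(1 - 2 * (M * β * η)) with hD
  have hD2 : D ^ 2 = 1 - 2 * (M * β * η) := by
    rw [hD]; exact Real.sq_sqrt (by linarith)
  have hMβ : M * β ≠ 0 := (mul_pos hM hβ).ne'
  have hsum : sstar + sss = 2 / (M * β) := by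
    rw [hs, hss]; field_simp; ring
  have hprod : sstar * sss = 2 * η / (M * β) := by
    rw [hs, hss, div_mul_div_comm]
    have e : (1 - D) * (1 + D) = 2 * (M * β * η) := by nlinarith [hD2]
    rw [e]; field_simp
  refine ⟨hsum, hprod, fun s => ?_⟩
  have e : M / 2 * (sstar - s) * (sss - s) = M / 2 * (sstar * sss) - M / 2 * (sstar + sss) * s
      + M / 2 * s ^ 2 := by ring
  rw [e, hsum, hprod]
  field_simp
  ring

/-- **Position of the zeros:** `0 ≤ η ≤ s* ≤ s**`, `s* ≤ 1/(Mβ) ≤ s**`, the cancellation-free form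
`s* = 2η/(1 + √(1 − 2h))`, and `s* ≤ 2η`.
[cite: EzquerrofernandezHernandezveron2017, §1.1.2 Theorem 1.21 (s* ≤ s**); §1.1 Theorem 1.1 (ρ* = (1 − √(1 − 2h))η/h, ρ** = (1 + √(1 − 2h))η/h)] -/
theorem kantorovichPolynomial_roots_le (hM : 0 < M) (hβ : 0 < β) (hη : 0 ≤ η)
    (hh : M * β * η ≤ 1 / 2)
    (hs : sstar = (1 - √(1 - 2 * (M * β * η))) / (M * β))
    (hss : sss = (1 + √(1 - 2 * (M * β * η))) / (M * β)) :
    sstar = 2 * η / (1 + √(1 - 2 * (M * β * η))) ∧ η ≤ sstar ∧ sstar ≤ 2 * η ∧ sstar ≤ sss ∧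
      sstar ≤ 1 / (M * β) ∧ 1 / (M * β) ≤ sss := by
  set D := √(1 - 2 * (M * β * η)) with hD
  have hD0 : 0 ≤ D := Real.sqrt_nonneg _
  have hD2 : D ^ 2 = 1 - 2 * (M * β * η) := by
    rw [hD]; exact Real.sq_sqrt (by linarith)
  have hD1 : D ≤ 1 := by nlinarith [mul_nonneg (mul_pos hM hβ).le hη]
  have hMβ : 0 < M * β := mul_pos hM hβ
  have hform : sstar = 2 * η / (1 + D) := by
    rw [hs, div_eq_div_iff hMβ.ne' (by linarith)]
    nlinarith [hD2]
  refine ⟨hform, ?_, ?_, ?_, ?_, ?_⟩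
  · rw [hform, le_div_iff₀ (by linarith)]; nlinarith
  · rw [hform, div_le_iff₀ (by linarith)]; nlinarith
  · rw [hs, hss]; exact div_le_div_of_nonneg_right (by linarith) hMβ.le
  · rw [hs]; exact div_le_div_of_nonneg_right (by linarith) hMβ.le
  · rw [hss]; exact div_le_div_of_nonneg_right (by linarith) hMβ.le

/-- **`s*` is a zero and `p > 0` to its left:** `p(s*) = 0 = p(s**)` and `p(s) > 0` for `s < s*`
(both factors of `(M/2)(s* − s)(s** − s)` are positive); in particular `s*` is the smallest zero of
`p` in `[0, ∞)` and `p > 0` on `[0, s*)`.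
[cite: EzquerrofernandezHernandezveron2017, §1.1.2 proof of Theorem 1.21 ("p(s) > 0 … in [0, s*)"); §1.1.4 Theorem 1.29] -/
theorem kantorovichPolynomial_zero_pos (hM : 0 < M) (hβ : 0 < β) (hη : 0 ≤ η) (hh : M * β * η ≤ 1 / 2)
    (hs : sstar = (1 - √(1 - 2 * (M * β * η))) / (M * β)) :
    M / 2 * sstar ^ 2 - sstar / β + η / β = 0 ∧
      ∀ s < sstar, 0 < M / 2 * s ^ 2 - s / β + η / β := by
  obtain ⟨-, -, hfac⟩ := kantorovichPolynomial_factor hM hβ hh hs rfl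
  obtain ⟨-, -, -, hle, -⟩ := kantorovichPolynomial_roots_le hM hβ hη hh hs rfl
  refine ⟨by rw [hfac]; ring, fun s hlt => ?_⟩
  rw [hfac]
  have h1 : 0 < sstar - s := sub_pos.2 hlt
  have h2 : 0 < (1 + √(1 - 2 * (M * β * η))) / (M * β) - s := by linarith
  positivity

/-- **Derivatives:** `p'(s) = Ms − 1/β` and `p''(s) = M`; `p'` is nondecreasing (convexity, `M ≥ 0`).
[cite: EzquerrofernandezHernandezveron2017, §1.1.2 proof of Theorem 1.21 ("p'(t) < 0 in [s₀, s*)"); §1.1.4 Theorem 1.29 (p solves the initial value problem p'' = M)] -/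
theorem kantorovichPolynomial_hasDerivAt (hM : 0 ≤ M) (s : ℝ) :
    HasDerivAt (fun s => M / 2 * s ^ 2 - s / β + η / β) (M * s - 1 / β) s ∧
      HasDerivAt (fun s => M * s - 1 / β) M s ∧ Monotone (fun s : ℝ => M * s - 1 / β) := by
  refine ⟨?_, ?_, fun a b hab => by simpa using mul_le_mul_of_nonneg_left hab hM⟩
  · have h1 : HasDerivAt (fun s => M / 2 * s ^ 2) (M / 2 * (2 * s)) s := by
      simpa using ((hasDerivAt_pow 2 s).const_mul (M / 2))
    have h2 : HasDerivAt (fun s => s / β) (1 / β) s := by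
      simpa using (hasDerivAt_id s).div_const β
    exact ((h1.sub h2).add_const (η / β)).congr_deriv (by ring)
  · simpa using ((hasDerivAt_id s).const_mul M).sub_const (1 / β)

/-- **Initial values (conditions (a) of Theorem 1.27 for the polynomial):** `p(0) = η/β`, `p'(0) = −1/β`,
so `−1/p'(0) = β` and `−p(0)/p'(0) = η` (the first Newton step from `s₀ = 0` is `s₁ = η`).
[cite: EzquerrofernandezHernandezveron2017, §1.1.4 Theorem 1.29 ("f(t) is a majorant function … that satisfies (a)-(b) of Theorem 1.27"); §1.1.2 (1.15) (s₁ = η)] -/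
theorem kantorovichPolynomial_init (hβ : 0 < β) :
    -1 / (M * 0 - 1 / β) = β ∧ -((M / 2 * 0 ^ 2 - 0 / β + η / β) / (M * 0 - 1 / β)) = η := by
  have hβ' : β ≠ 0 := hβ.ne'
  constructor
  · field_simp; ring
  · field_simp; ring

end KantorovichPolynomial

section KantorovichSequence

variable {M β η sstar sss : ℝ} {s : ℕ → ℝ}

/-- **Theorem 1.21:** the Newton sequence of Kantorovich's polynomial, `s₀ = 0`,
`s_{n+1} = sₙ − p(sₙ)/p'(sₙ)`, stays in `[0, s*]`, is nondecreasing, and converges to the smallest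
positive zero `s*`; its first term is `s₁ = η`.
[cite: EzquerrofernandezHernandezveron2017, §1.1.2 Theorem 1.21 with proof (p. 48–49)] -/
theorem kantorovich_seq_tendsto (hM : 0 < M) (hβ : 0 < β) (hη : 0 ≤ η) (hh : M * β * η ≤ 1 / 2)
    (hs : sstar = (1 - √(1 - 2 * (M * β * η))) / (M * β)) (hs0 : s 0 = 0)
    (hstep : ∀ n, s (n + 1) = s n - (M / 2 * s n ^ 2 - s n / β + η / β) / (M * s n - 1 / β)) :
    (∀ n, s n ∈ Icc 0 sstar) ∧ Monotone s ∧ Tendsto s atTop (𝓝 sstar) ∧ s 1 = η := by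
  obtain ⟨hzero, hpos⟩ := kantorovichPolynomial_zero_pos hM hβ hη hh hs
  obtain ⟨-, hηle, -⟩ := kantorovichPolynomial_roots_le hM hβ hη hh hs rfl
  have hder := fun x (_ : x ∈ Icc (0:ℝ) sstar) => (kantorovichPolynomial_hasDerivAt (β := β)
    (η := η) hM.le x).1
  have hmono : MonotoneOn (fun x : ℝ => M * x - 1 / β) (Icc 0 sstar) :=
    ((kantorovichPolynomial_hasDerivAt (β := β) (η := η) hM.le 0).2.2).monotoneOn _
  have hpos' : ∀ x ∈ Ico (0:ℝ) sstar, 0 < M / 2 * x ^ 2 - x / β + η / β := fun x hx => hpos x hx.2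
  have h0s : (0:ℝ) ≤ sstar := hη.trans hηle
  refine ⟨newtonMajorant_seq_mem_Icc hder hmono hzero hpos' h0s hs0 hstep,
    (newtonMajorant_seq_monotone hder hmono hzero hpos' h0s hs0 hstep).1,
    newtonMajorant_seq_tendsto hder hmono hzero hpos' h0s hs0 hstep, ?_⟩
  rw [hstep 0, hs0]
  have := (kantorovichPolynomial_init (M := M) (η := η) hβ).2
  linarith

/-- **Ostrowski's recurrences:** with `aₙ = s* − sₙ` and `bₙ = s** − sₙ` one has
`p(sₙ) = (M/2)aₙbₙ`, `p'(sₙ) = −(M/2)(aₙ + bₙ)`, hence `s_{n+1} − sₙ = aₙbₙ/(aₙ + bₙ)`,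
`a_{n+1} = aₙ²/(aₙ + bₙ)`, `b_{n+1} = bₙ²/(aₙ + bₙ)` and `bₙ − aₙ = s** − s*` (Theorem 2.18 with
`g ≡ M/2`, where `Q₁ ≡ 1`).
[cite: EzquerrofernandezHernandezveron2017, §2.1.3.4 Theorem 2.18 and its proof (aₙ = t* − tₙ, bₙ = t** − tₙ, φ(tₙ) = aₙbₙg(tₙ), φ'(tₙ) = aₙbₙg'(tₙ) − (aₙ + bₙ)g(tₙ)), p. 86] -/
theorem kantorovich_seq_recurrence (hM : 0 < M) (hβ : 0 < β) (hη : 0 ≤ η) (hh : M * β * η ≤ 1 / 2)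
    (hs : sstar = (1 - √(1 - 2 * (M * β * η))) / (M * β))
    (hss : sss = (1 + √(1 - 2 * (M * β * η))) / (M * β)) (hs0 : s 0 = 0)
    (hstep : ∀ n, s (n + 1) = s n - (M / 2 * s n ^ 2 - s n / β + η / β) / (M * s n - 1 / β))
    (n : ℕ) :
    s (n + 1) - s n = (sstar - s n) * (sss - s n) / ((sstar - s n) + (sss - s n)) ∧
      sstar - s (n + 1) = (sstar - s n) ^ 2 / ((sstar - s n) + (sss - s n)) ∧
      sss - s (n + 1) = (sss - s n) ^ 2 / ((sstar - s n) + (sss - s n)) ∧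
      0 ≤ sstar - s n ∧ sstar - s n ≤ sss - s n := by
  obtain ⟨hsum, -, hfac⟩ := kantorovichPolynomial_factor hM hβ hh hs hss
  obtain ⟨-, -, -, hle, -⟩ := kantorovichPolynomial_roots_le hM hβ hη hh hs hss
  obtain ⟨hmem, -, -, -⟩ := kantorovich_seq_tendsto hM hβ hη hh hs hs0 hstep
  have ha : 0 ≤ sstar - s n := sub_nonneg.2 (hmem n).2
  have hab : sstar - s n ≤ sss - s n := by linarith
  have hMβ : M * β ≠ 0 := (mul_pos hM hβ).ne'
  -- `p'(sₙ) = −(M/2)(aₙ + bₙ)`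
  have hder : M * s n - 1 / β = -(M / 2) * ((sstar - s n) + (sss - s n)) := by
    have e : (sstar - s n) + (sss - s n) = 2 / (M * β) - 2 * s n := by rw [← hsum]; ring
    rw [e]; field_simp; ring
  have hstep' : s (n + 1) - s n = (sstar - s n) * (sss - s n) / ((sstar - s n) + (sss - s n)) := by
    rw [hstep n, hfac (s n), hder]
    rcases eq_or_ne ((sstar - s n) + (sss - s n)) 0 with h0 | h0
    · rw [h0]; simp
    · field_simp; ring
  refine ⟨hstep', ?_, ?_, ha, hab⟩
  · rcases eq_or_ne ((sstar - s n) + (sss - s n)) 0 with h0 | h0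
    · have : sstar - s n = 0 := by linarith
      have e : sstar - s (n + 1) = (sstar - s n) - (s (n + 1) - s n) := by ring
      rw [e, hstep', h0, this]; simp
    · have e : sstar - s (n + 1) = (sstar - s n) - (s (n + 1) - s n) := by ring
      rw [e, hstep']; field_simp; ring
  · rcases eq_or_ne ((sstar - s n) + (sss - s n)) 0 with h0 | h0
    · have h1 : sstar - s n = 0 := by linarith
      have h2 : sss - s n = 0 := by linarith
      have e : sss - s (n + 1) = (sss - s n) - (s (n + 1) - s n) := by ring
      rw [e, hstep', h0, h2]; simp
    · have e : sss - s (n + 1) = (sss - s n) - (s (n + 1) - s n) := by ring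
      rw [e, hstep']; field_simp; ring

/-- **The closed form for `h < 1/2` (Ostrowski; Theorem 2.18 with `Q₁ ≡ 1`):** if `s* < s**` then, with
`θ = s*/s** ∈ [0, 1)`, `s* − sₙ = θ^(2ⁿ) (s** − sₙ)` and `s* − sₙ = (s** − s*) θ^(2ⁿ) / (1 − θ^(2ⁿ))`.
[cite: EzquerrofernandezHernandezveron2017, §2.1.3.4 Theorem 2.18 (a) (t* − tₙ = (t** − t*)θ^(2ⁿ)/(m₁ − θ^(2ⁿ)) with m₁ = M₁ = 1 for the polynomial) and its proof; §1.1 (1.2)] -/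
theorem kantorovich_seq_closed_form (hM : 0 < M) (hβ : 0 < β) (hη : 0 ≤ η) (hh : M * β * η ≤ 1 / 2)
    (hs : sstar = (1 - √(1 - 2 * (M * β * η))) / (M * β))
    (hss : sss = (1 + √(1 - 2 * (M * β * η))) / (M * β)) (hs0 : s 0 = 0)
    (hstep : ∀ n, s (n + 1) = s n - (M / 2 * s n ^ 2 - s n / β + η / β) / (M * s n - 1 / β))
    (hlt : sstar < sss) {θ : ℝ} (hθ : θ = sstar / sss) (n : ℕ) :
    0 ≤ θ ∧ θ < 1 ∧ sstar - s n = θ ^ (2 ^ n) * (sss - s n) ∧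
      sstar - s n = (sss - sstar) * θ ^ (2 ^ n) / (1 - θ ^ (2 ^ n)) := by
  have hrec := kantorovich_seq_recurrence hM hβ hη hh hs hss hs0 hstep
  obtain ⟨-, hηle, -⟩ := kantorovichPolynomial_roots_le hM hβ hη hh hs hss
  have hs0' : 0 ≤ sstar := hη.trans hηle
  have hsss : 0 < sss := lt_of_le_of_lt hs0' hlt
  have hθ0 : 0 ≤ θ := by rw [hθ]; exact div_nonneg hs0' hsss.le
  have hθ1 : θ < 1 := by rw [hθ, div_lt_one hsss]; exact hlt
  -- `aₙ = θ^(2ⁿ) bₙ` by induction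
  have key : ∀ n, sstar - s n = θ ^ (2 ^ n) * (sss - s n) := by
    intro n
    induction n with
    | zero => rw [hs0, hθ, sub_zero, sub_zero, pow_zero, pow_one, div_mul_cancel₀ _ hsss.ne']
    | succ n ih =>
      obtain ⟨-, ha, hb, ha0, hab⟩ := hrec n
      have hbpos : 0 < sss - s n := by linarith
      have e : θ ^ (2 ^ (n + 1)) = (θ ^ (2 ^ n)) ^ 2 := by rw [← pow_mul, pow_succ]
      rw [ha, hb, e, ih]
      have hden : (θ ^ (2 ^ n) * (sss - s n) + (sss - s n)) ≠ 0 := by positivity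
      field_simp
  refine ⟨hθ0, hθ1, key n, ?_⟩
  have hN : θ ^ (2 ^ n) < 1 := pow_lt_one₀ hθ0 hθ1 (by positivity)
  have k := key n
  have hb' : sss - s n = (sstar - s n) + (sss - sstar) := by ring
  rw [hb'] at k
  have h2 : (sstar - s n) * (1 - θ ^ (2 ^ n)) = (sss - sstar) * θ ^ (2 ^ n) := by
    linear_combination k
  rw [eq_div_iff (by linarith)]
  linarith

/-- **The closed form for `h = 1/2`:** if `s* = s**` then `s* − s_{n+1} = (s* − sₙ)/2`, hence
`s* − sₙ = s*/2ⁿ` (linear convergence with rate `1/2`; Theorem 2.18 (b) with `m₂ = M₂ = 1/2`).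
[cite: EzquerrofernandezHernandezveron2017, §2.1.3.4 Theorem 2.18 (b) and its proof; §1.1 Theorem 1.1 (case h = 1/2)] -/
theorem kantorovich_seq_closed_form_eq (hM : 0 < M) (hβ : 0 < β) (hη : 0 ≤ η) (hh : M * β * η ≤ 1 / 2)
    (hs : sstar = (1 - √(1 - 2 * (M * β * η))) / (M * β))
    (hss : sss = (1 + √(1 - 2 * (M * β * η))) / (M * β)) (hs0 : s 0 = 0)
    (hstep : ∀ n, s (n + 1) = s n - (M / 2 * s n ^ 2 - s n / β + η / β) / (M * s n - 1 / β))
    (heq : sstar = sss) (n : ℕ) :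
    sstar - s (n + 1) = (sstar - s n) / 2 ∧ sstar - s n = sstar / 2 ^ n := by
  have hrec := kantorovich_seq_recurrence hM hβ hη hh hs hss hs0 hstep
  have half : ∀ n, sstar - s (n + 1) = (sstar - s n) / 2 := by
    intro n
    obtain ⟨-, ha, -, ha0, -⟩ := hrec n
    rw [ha, ← heq]
    rcases ha0.eq_or_lt with h0 | h0
    · rw [← h0]; simp
    · field_simp; ring
  refine ⟨half n, ?_⟩
  induction n with
  | zero => rw [hs0]; simp
  | succ n ih => rw [half n, ih, pow_succ]; ring

/-- **A posteriori form of the error:** `s* − sₙ ≤ 2(s_{n+1} − sₙ)` (from `aₙ ≤ bₙ`: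
`aₙ(aₙ + bₙ) ≤ 2aₙbₙ`), the scalar shadow of `‖x* − xₙ‖ ≤ ηₙφ(hₙ) ≤ 2ηₙ` in (1.6).
[cite: EzquerrofernandezHernandezveron2017, §1.1 proof of Theorem 1.1, (1.6) (‖x_{n+m} − xₙ‖ ≤ ηₙφ(hₙ) ≤ 2ηₙ), p. 35] -/
theorem kantorovich_seq_error_le_two_steps (hM : 0 < M) (hβ : 0 < β) (hη : 0 ≤ η)
    (hh : M * β * η ≤ 1 / 2) (hs : sstar = (1 - √(1 - 2 * (M * β * η))) / (M * β)) (hs0 : s 0 = 0)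
    (hstep : ∀ n, s (n + 1) = s n - (M / 2 * s n ^ 2 - s n / β + η / β) / (M * s n - 1 / β))
    (n : ℕ) : sstar - s n ≤ 2 * (s (n + 1) - s n) := by
  obtain ⟨hst, -, -, ha0, hab⟩ := kantorovich_seq_recurrence hM hβ hη hh hs rfl hs0 hstep n
  rw [hst]
  set a := sstar - s n
  set b := (1 + √(1 - 2 * (M * β * η))) / (M * β) - s n
  rcases ha0.eq_or_lt with h0 | h0
  · rw [← h0]; simp
  · have hab' : 0 < a + b := by linarith
    rw [mul_div_assoc', le_div_iff₀ hab']
    nlinarith [mul_le_mul_of_nonneg_left hab ha0]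

/-- Elementary algebra of one Ostrowski step: with `a' = a²/(a + b)`, `b' = b²/(a + b)` the next step
`a'b'/(a' + b')` equals `(ab/(a² + b²)) · (ab/(a + b))`. [folklore] -/
private theorem kpAux_step {a b : ℝ} (ha : 0 ≤ a) (hab : a ≤ b) :
    a ^ 2 / (a + b) * (b ^ 2 / (a + b)) / (a ^ 2 / (a + b) + b ^ 2 / (a + b))
      = a * b / (a ^ 2 + b ^ 2) * (a * b / (a + b)) := by
  rcases (ha.trans hab).eq_or_lt with hb0 | hb0
  · have hza : a = 0 := le_antisymm (hb0 ▸ hab) ha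
    subst hza; rw [← hb0]; simp
  · have h1 : 0 < a + b := by linarith
    have h2 : 0 < a ^ 2 + b ^ 2 := by positivity
    field_simp

/-- Elementary algebra of one Ostrowski step: the contraction factor `q = ab/(a² + b²)` lies in
`[0, 1/2]` and the next one, `a'b'/(a'² + b'²) = a²b²/(a⁴ + b⁴)`, is at most `2q²`. [folklore] -/
private theorem kpAux_contraction {a b : ℝ} (ha : 0 ≤ a) (hab : a ≤ b) :
    0 ≤ a * b / (a ^ 2 + b ^ 2) ∧ a * b / (a ^ 2 + b ^ 2) ≤ 1 / 2 ∧
      a ^ 2 / (a + b) * (b ^ 2 / (a + b)) / ((a ^ 2 / (a + b)) ^ 2 + (b ^ 2 / (a + b)) ^ 2)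
        ≤ 2 * (a * b / (a ^ 2 + b ^ 2)) ^ 2 := by
  rcases (ha.trans hab).eq_or_lt with hb0 | hb0
  · have hza : a = 0 := le_antisymm (hb0 ▸ hab) ha
    subst hza; rw [← hb0]; simp
  · have h1 : 0 < a + b := by linarith
    have h2 : 0 < a ^ 2 + b ^ 2 := by positivity
    have h3 : 0 < a ^ 4 + b ^ 4 := by positivity
    refine ⟨div_nonneg (mul_nonneg ha hb0.le) h2.le, ?_, ?_⟩
    · rw [div_le_iff₀ h2]; nlinarith [sq_nonneg (a - b)]
    · have e1 : a ^ 2 / (a + b) * (b ^ 2 / (a + b)) / ((a ^ 2 / (a + b)) ^ 2 + (b ^ 2 / (a + b)) ^ 2)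
          = a ^ 2 * b ^ 2 / (a ^ 4 + b ^ 4) := by
        field_simp
      have e2 : 2 * (a * b / (a ^ 2 + b ^ 2)) ^ 2 = 2 * (a ^ 2 * b ^ 2) / (a ^ 2 + b ^ 2) ^ 2 := by
        rw [div_pow]; ring
      rw [e1, e2, div_le_div_iff₀ h3 (by positivity)]
      have h4 : (a ^ 2 + b ^ 2) ^ 2 ≤ 2 * (a ^ 4 + b ^ 4) := by nlinarith [sq_nonneg (a ^ 2 - b ^ 2)]
      have h5 : 0 ≤ a ^ 2 * b ^ 2 := by positivity
      nlinarith [mul_le_mul_of_nonneg_left h4 h5]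

/-- **Kantorovich's numbers along the majorant sequence:** with `ηₙ = s_{n+1} − sₙ` and the contraction
factor `qₙ = aₙbₙ/(aₙ² + bₙ²)` (`= hₙ/(2(1 − hₙ))` for `hₙ = 2aₙbₙ/(aₙ + bₙ)²`, the number `hₙ = Mβₙηₙ`
of Kantorovich's proof evaluated exactly on the polynomial), one has `η_{n+1} = qₙ ηₙ`, `0 ≤ qₙ ≤ 1/2`,
`q_{n+1} ≤ 2qₙ²` (the scalar form of `h_{n+1} = hₙ²/(2(1 − hₙ)²) ≤ 2hₙ²`, (1.5)) and `q₀ = h/(2(1 − h)) ≤ h`.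
[cite: EzquerrofernandezHernandezveron2017, §1.1 proof of Theorem 1.1, (1.3)–(1.5) (ηₙ = h_{n−1}η_{n−1}/(2(1 − h_{n−1})), hₙ = h_{n−1}²/(2(1 − h_{n−1})²) ≤ 2h_{n−1}²), p. 33–34] -/
theorem kantorovich_seq_contraction (hM : 0 < M) (hβ : 0 < β) (hη : 0 ≤ η) (hh : M * β * η ≤ 1 / 2)
    (hs : sstar = (1 - √(1 - 2 * (M * β * η))) / (M * β))
    (hss : sss = (1 + √(1 - 2 * (M * β * η))) / (M * β)) (hs0 : s 0 = 0)
    (hstep : ∀ n, s (n + 1) = s n - (M / 2 * s n ^ 2 - s n / β + η / β) / (M * s n - 1 / β))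
    {q : ℕ → ℝ}
    (hq : ∀ n, q n = (sstar - s n) * (sss - s n) / ((sstar - s n) ^ 2 + (sss - s n) ^ 2)) (n : ℕ) :
    s (n + 2) - s (n + 1) = q n * (s (n + 1) - s n) ∧ 0 ≤ q n ∧ q n ≤ 1 / 2 ∧
      q (n + 1) ≤ 2 * q n ^ 2 ∧ q 0 = M * β * η / (2 * (1 - M * β * η)) ∧ q 0 ≤ M * β * η := by
  have hrec := kantorovich_seq_recurrence hM hβ hη hh hs hss hs0 hstep
  obtain ⟨hsum, hprod, -⟩ := kantorovichPolynomial_factor hM hβ hh hs hss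
  obtain ⟨hst, ha, hb, ha0, hab⟩ := hrec n
  obtain ⟨hst1, -, -, -, -⟩ := hrec (n + 1)
  obtain ⟨hq0, hqhalf, hnext⟩ := kpAux_contraction ha0 hab
  refine ⟨?_, by rw [hq n]; exact hq0, by rw [hq n]; exact hqhalf, ?_, ?_, ?_⟩
  · rw [hst1, ha, hb, kpAux_step ha0 hab, hq n, hst]
  · rw [hq (n + 1), hq n, ha, hb]; exact hnext
  · have hMβ : M * β ≠ 0 := (mul_pos hM hβ).ne'
    have e2 : sstar ^ 2 + sss ^ 2 = (sstar + sss) ^ 2 - 2 * (sstar * sss) := by ring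
    rw [hq 0, hs0, sub_zero, sub_zero, e2, hsum, hprod]
    have h1 : (1 : ℝ) - M * β * η ≠ 0 := by linarith
    field_simp
  · have hMβ : M * β ≠ 0 := (mul_pos hM hβ).ne'
    have e2 : sstar ^ 2 + sss ^ 2 = (sstar + sss) ^ 2 - 2 * (sstar * sss) := by ring
    have h4 : q 0 = M * β * η / (2 * (1 - M * β * η)) := by
      rw [hq 0, hs0, sub_zero, sub_zero, e2, hsum, hprod]
      have h1 : (1 : ℝ) - M * β * η ≠ 0 := by linarith
      field_simp
    rw [h4, div_le_iff₀ (by linarith)]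
    nlinarith [mul_nonneg (mul_pos hM hβ).le hη]

/-- **Kantorovich's a priori estimates (1.4) and (1.2) on the majorant sequence:** with `h = Mβη ≤ 1/2`,
`2qₙ ≤ (2h)^(2ⁿ)`, the steps satisfy `s_{n+1} − sₙ ≤ (1/2ⁿ)(2h)^(2ⁿ − 1) η` and the errors
`s* − sₙ ≤ (1/2^(n−1)) (2h)^(2ⁿ − 1) η` — the right-hand side of (1.2), which bounds `‖x* − xₙ‖ ≤ s* − sₙ`
in the Newton–Kantorovich theorem.
[cite: EzquerrofernandezHernandezveron2017, §1.1 Theorem 1.1 (1.2) and its proof, (1.4)–(1.6), p. 33–35] -/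
theorem kantorovich_seq_error_le (hM : 0 < M) (hβ : 0 < β) (hη : 0 ≤ η) (hh : M * β * η ≤ 1 / 2)
    (hs : sstar = (1 - √(1 - 2 * (M * β * η))) / (M * β)) (hs0 : s 0 = 0)
    (hstep : ∀ n, s (n + 1) = s n - (M / 2 * s n ^ 2 - s n / β + η / β) / (M * s n - 1 / β))
    (n : ℕ) :
    s (n + 1) - s n ≤ 1 / 2 ^ n * (2 * (M * β * η)) ^ (2 ^ n - 1) * η ∧
      sstar - s n ≤ 2 / 2 ^ n * (2 * (M * β * η)) ^ (2 ^ n - 1) * η := by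
  set hK := M * β * η with hK_def
  have hK0 : 0 ≤ hK := mul_nonneg (mul_pos hM hβ).le hη
  set q : ℕ → ℝ := fun n => (sstar - s n) * ((1 + √(1 - 2 * hK)) / (M * β) - s n) /
    ((sstar - s n) ^ 2 + ((1 + √(1 - 2 * hK)) / (M * β) - s n) ^ 2) with hq_def
  have hcon := fun n => kantorovich_seq_contraction hM hβ hη hh hs rfl hs0 hstep (q := q) (fun n => rfl) n
  -- `2 qₙ ≤ (2h)^(2ⁿ)`
  have hq2 : ∀ n, 2 * q n ≤ (2 * hK) ^ (2 ^ n) := by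
    intro n
    induction n with
    | zero => have := (hcon 0).2.2.2.2.2; simp only [pow_zero, pow_one]; linarith
    | succ n ih =>
      have h3 := (hcon n).2.2.2.1
      have hq0 := (hcon n).2.1
      calc 2 * q (n + 1) ≤ (2 * q n) ^ 2 := by nlinarith
        _ ≤ ((2 * hK) ^ (2 ^ n)) ^ 2 := pow_le_pow_left₀ (by linarith) ih 2
        _ = (2 * hK) ^ (2 ^ (n + 1)) := by rw [← pow_mul, pow_succ]
  -- (1.4): `ηₙ ≤ (1/2ⁿ)(2h)^(2ⁿ − 1) η`
  have hstep1 : s 1 - s 0 = η := by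
    have := (kantorovich_seq_tendsto hM hβ hη hh hs hs0 hstep).2.2.2
    rw [this, hs0, sub_zero]
  have h14 : ∀ n, s (n + 1) - s n ≤ 1 / 2 ^ n * (2 * hK) ^ (2 ^ n - 1) * η := by
    intro n
    induction n with
    | zero => rw [hstep1]; simp
    | succ n ih =>
      have e := (hcon n).1
      have hq0 := (hcon n).2.1
      have hηn : 0 ≤ s (n + 1) - s n := by
        have := (kantorovich_seq_tendsto hM hβ hη hh hs hs0 hstep).2.1
        exact sub_nonneg.2 (this (Nat.le_succ n))
      rw [show n + 1 + 1 = n + 2 by ring, e]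
      have hpow : (2 * hK) ^ (2 ^ n) * (2 * hK) ^ (2 ^ n - 1) = (2 * hK) ^ (2 ^ (n + 1) - 1) := by
        rw [← pow_add]; congr 1
        have := Nat.one_le_two_pow (n := n)
        rw [pow_succ]; omega
      calc q n * (s (n + 1) - s n)
          ≤ ((2 * hK) ^ (2 ^ n) / 2) * (1 / 2 ^ n * (2 * hK) ^ (2 ^ n - 1) * η) :=
            mul_le_mul (by linarith [hq2 n]) ih hηn (by positivity)
        _ = 1 / 2 ^ (n + 1) * ((2 * hK) ^ (2 ^ n) * (2 * hK) ^ (2 ^ n - 1)) * η := by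
            rw [pow_succ]; ring
        _ = 1 / 2 ^ (n + 1) * (2 * hK) ^ (2 ^ (n + 1) - 1) * η := by rw [hpow]
  refine ⟨h14 n, ?_⟩
  -- (1.2): `s* − sₙ ≤ 2ηₙ ≤ …`
  have h2 := kantorovich_seq_error_le_two_steps hM hβ hη hh hs hs0 hstep n
  calc sstar - s n ≤ 2 * (s (n + 1) - s n) := h2
    _ ≤ 2 * (1 / 2 ^ n * (2 * hK) ^ (2 ^ n - 1) * η) := by linarith [h14 n]
    _ = 2 / 2 ^ n * (2 * hK) ^ (2 ^ n - 1) * η := by ring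

end KantorovichSequence

end Literature.Analysis.Calculus
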